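import Literature.Computability.QuantumComplexity.LetterWord
import HarnessLib

/-!
# A concrete gadget kit inside a block of wires

Topic `Literature/Computability/QuantumComplexity`; a step in the discharge of
`ajl_jonesApproxProblem_mem_PromiseBQP` (the wire bookkeeping of one Hadamard-test copy). For
`n` strands, `r` slots and `k` averaging bits we lay out a block of `bsize n r k` wires: a data
area (test qubit, path register, table, dummy, Hadamard wires, helpers) followed by the classical
region (registers, flags, scratch) of the letter programs, and prove that the resulting
`GadgetKit` is well formed (`kit_ok`). The register/flag/scratch bounds are the maxima over the six
letter programs (`kitR`, `kitF`, `kitT`).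

## References

* D. Aharonov, V. Jones, Z. Landau, Algorithmica 55 (2009), §3.3 (resources of one trial)
  [AharonovJonesLandau2009].
* M. A. Nielsen, I. L. Chuang, *Quantum Computation and Quantum Information*, CUP 2010, §3.2.5
  (ancilla bookkeeping) [NielsenChuang2010].
-/

namespace Literature.Computability.QuantumComplexity

open Cryptography RevSim

namespace BlockKit

/-! ### Sizes -/

/-- Maximum of a list of naturals. [folklore] -/
def lmax (l : List ℕ) : ℕ := l.foldr max 0

/-- Members are below the maximum. [folklore] -/
theorem le_lmax {l : List ℕ} {a : ℕ} (h : a ∈ l) : a ≤ lmax l := by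
  induction l with
  | nil => simp at h
  | cons x l ih =>
    simp only [lmax, List.foldr_cons]
    rcases List.mem_cons.1 h with rfl | h
    · exact le_max_left _ _
    · exact (ih h).trans (le_max_right _ _)

/-- Registers needed by the letter programs. [folklore] -/
noncomputable def kitR (k : ℕ) : ℕ := lmax ((SLP.letterPrograms k).map fun b => (b.compile (SLP.thrWd k) 0 0).2.2.1)

/-- Flags needed by the letter programs. [folklore] -/
noncomputable def kitF (k : ℕ) : ℕ := lmax ((SLP.letterPrograms k).map fun b => (b.compile (SLP.thrWd k) 0 0).2.2.2)

/-- Instruction slots needed by the letter programs. [folklore] -/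
noncomputable def kitT (k : ℕ) : ℕ := lmax ((SLP.letterPrograms k).map fun b => (b.compile (SLP.thrWd k) 0 0).1.length)

/-- The register bound dominates. [folklore] -/
theorem le_kitR {k : ℕ} {b : SLP.BExpr} (hb : b ∈ SLP.letterPrograms k) : (b.compile (SLP.thrWd k) 0 0).2.2.1 ≤ kitR k :=
  le_lmax (List.mem_map.2 ⟨b, hb, rfl⟩)

/-- The flag bound dominates. [folklore] -/
theorem le_kitF {k : ℕ} {b : SLP.BExpr} (hb : b ∈ SLP.letterPrograms k) : (b.compile (SLP.thrWd k) 0 0).2.2.2 ≤ kitF k :=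
  le_lmax (List.mem_map.2 ⟨b, hb, rfl⟩)

/-- The slot bound dominates. [folklore] -/
theorem le_kitT {k : ℕ} {b : SLP.BExpr} (hb : b ∈ SLP.letterPrograms k) : (b.compile (SLP.thrWd k) 0 0).1.length ≤ kitT k :=
  le_lmax (List.mem_map.2 ⟨b, hb, rfl⟩)

-- the bounds are data for the layout only: never unfold them again (unfolding evaluates the compiler symbolically)
attribute [irreducible] kitR kitF kitT

/-- The size of the classical region. [folklore] -/
noncomputable def regionSize (k : ℕ) : ℕ := kitR k * SLP.thrWd k + kitF k + kitT k * SLP.scrSize (SLP.thrWd k)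

/-- The number of letters `(i, ±)`, `i < n - 1`. [folklore] -/
def A (n : ℕ) : ℕ := 2 * (n - 1)

/-- Offset of the dummy wire: after the test qubit, the path register and the table. [folklore] -/
def dataOff (n r : ℕ) : ℕ := 1 + 2 * (n + 1) + r * A n

/-- Base of the register block: after dummy, `cr`, `k` averaging wires and `k + regionSize` helpers. [folklore] -/
noncomputable def rb (n r k : ℕ) : ℕ := dataOff n r + 2 + k + (k + regionSize k)

/-- The block size. [folklore] -/
noncomputable def bsize (n r k : ℕ) : ℕ := rb n r k + regionSize k

/-- Blocks are nonempty. [folklore] -/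
theorem bsize_pos (n r k : ℕ) : 0 < bsize n r k := by unfold bsize rb dataOff; omega

variable (n r k : ℕ)

/-- Wire number `v` of the block. [folklore] -/
noncomputable def wire (v : ℕ) : Fin (bsize n r k) := finOf (bsize n r k) (bsize_pos n r k) v

/-- `wire v` has value `v` below the block size. [folklore] -/
theorem wire_val {v : ℕ} (hv : v < bsize n r k) : (wire n r k v : ℕ) = v := by
  rw [wire, finOf_of_lt _ hv]

/-- `wire` is injective below the block size. [folklore] -/
theorem wire_inj {v v' : ℕ} (hv : v < bsize n r k) (hv' : v' < bsize n r k) (h : wire n r k v = wire n r k v') : v = v' := by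
  have := congrArg Fin.val h; rwa [wire_val n r k hv, wire_val n r k hv'] at this

/-! ### The kit -/

/-- **The gadget kit of a block.** [folklore] -/
noncomputable def kit : GadgetKit (bsize n r k) where
  hN := bsize_pos n r k
  k := k
  as := (List.range k).map fun j => wire n r k (dataOff n r + 2 + j)
  cr := wire n r k (dataOff n r + 1)
  rb := rb n r k
  fb := rb n r k + kitR k * SLP.thrWd k
  sb := rb n r k + kitR k * SLP.thrWd k + kitF k
  R := kitR k
  F := kitF k
  T := kitT k
  hs := (List.range (k + regionSize k)).map fun j => wire n r k (dataOff n r + 2 + k + j)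
  d0 := wire n r k (dataOff n r)

/-- The fields of the kit (definitional). [folklore] -/
theorem kit_as : (kit n r k).as = (List.range k).map fun j => wire n r k (dataOff n r + 2 + j) := rfl
/-- The fields of the kit (definitional). [folklore] -/
theorem kit_cr : (kit n r k).cr = wire n r k (dataOff n r + 1) := rfl
/-- The fields of the kit (definitional). [folklore] -/
theorem kit_hs : (kit n r k).hs = (List.range (k + regionSize k)).map fun j => wire n r k (dataOff n r + 2 + k + j) := rfl
/-- The fields of the kit (definitional). [folklore] -/
theorem kit_d0 : (kit n r k).d0 = wire n r k (dataOff n r) := rfl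
/-- The fields of the kit (definitional). [folklore] -/
theorem kit_rb : (kit n r k).rb = rb n r k := rfl
/-- The fields of the kit (definitional). [folklore] -/
theorem kit_k : (kit n r k).k = k := rfl
/-- The fields of the kit (definitional). [folklore] -/
theorem kit_fb : (kit n r k).fb = rb n r k + kitR k * SLP.thrWd k := rfl
/-- The fields of the kit (definitional). [folklore] -/
theorem kit_sb : (kit n r k).sb = rb n r k + kitR k * SLP.thrWd k + kitF k := rfl
/-- The fields of the kit (definitional). [folklore] -/
theorem kit_T : (kit n r k).T = kitT k := rfl

/-- The region of the kit has `regionSize` wires. [folklore] -/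
theorem length_region : (kit n r k).region.length = regionSize k := by
  rw [GadgetKit.region, layoutRegion, List.length_map, List.length_append, List.length_append, List.length_map, List.length_map, List.length_map,
    List.length_range, List.length_range, List.length_range]
  rfl

/-- **The kit of a block is well formed** (for `k ≥ 1`). [folklore] -/
theorem kit_ok (hk : 1 ≤ k) : (kit n r k).OK := by
  have hrb : rb n r k = dataOff n r + 2 + k + (k + regionSize k) := rfl
  have hb : bsize n r k = rb n r k + regionSize k := rfl
  refine
    { len := by rw [kit_as, List.length_map, List.length_range]; rfl
      nodup := ?_
      had_lt := ?_
      d0_lt := by rw [kit_d0, kit_rb, wire_val n r k (by omega)]; omega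
      d0_notin := ?_
      fb_ge := le_rfl
      sb_ge := le_rfl
      top_le := by rw [kit_sb, kit_T, show (kit n r k).Wd = SLP.thrWd k from rfl, hb, regionSize]; omega
      hs_len := by rw [List.length_append, length_region, kit_as, kit_hs, List.length_map, List.length_map, List.length_range, List.length_range]
      hs_ne := by rw [kit_hs]; intro h; have := congrArg List.length h; rw [List.length_map, List.length_range] at this; simp at this; omega
      hs_nodup := ?_
      hs_low := ?_
      hs_had := ?_
      hs_d0 := ?_
      R_ge := fun b hb' => le_kitR hb'
      F_ge := fun b hb' => le_kitF hb'
      T_ge := fun b hb' => le_kitT hb' }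
  · -- nodup (cr :: as)
    rw [kit_cr, kit_as, List.nodup_cons]
    refine ⟨fun h => ?_, ?_⟩
    · rw [List.mem_map] at h; obtain ⟨j, hj, h⟩ := h; rw [List.mem_range] at hj
      have := wire_inj n r k (by omega) (by omega) h; omega
    · refine List.nodup_range.map_on fun j hj j' hj' h => ?_
      rw [List.mem_range] at hj hj'
      have := wire_inj n r k (by omega) (by omega) h; omega
  · -- had_lt
    intro a ha
    rw [kit_cr, kit_as, List.mem_cons, List.mem_map] at ha
    rw [kit_rb]
    rcases ha with rfl | ⟨j, hj, rfl⟩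
    · rw [wire_val n r k (by omega)]; omega
    · rw [List.mem_range] at hj; rw [wire_val n r k (by omega)]; omega
  · -- d0_notin
    rw [kit_d0, kit_cr, kit_as, List.mem_cons, List.mem_map, not_or]
    refine ⟨fun h => ?_, ?_⟩
    · have := wire_inj n r k (by omega) (by omega) h; omega
    · rintro ⟨j, hj, h⟩; rw [List.mem_range] at hj
      have := wire_inj n r k (by omega) (by omega) h; omega
  · -- hs_nodup
    rw [kit_hs]
    refine List.nodup_range.map_on fun j hj j' hj' h => ?_
    rw [List.mem_range] at hj hj'
    have := wire_inj n r k (by omega) (by omega) h; omega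
  · -- hs_low
    intro h hh
    rw [kit_hs, List.mem_map] at hh
    obtain ⟨j, hj, rfl⟩ := hh
    rw [List.mem_range] at hj
    rw [kit_rb, wire_val n r k (by omega)]; omega
  · -- hs_had
    intro h hh hmem
    rw [kit_hs, List.mem_map] at hh
    obtain ⟨j, hj, rfl⟩ := hh
    rw [List.mem_range] at hj
    rw [kit_cr, kit_as, List.mem_cons, List.mem_map] at hmem
    rcases hmem with h1 | ⟨j', hj', h2⟩
    · have := wire_inj n r k (by omega) (by omega) h1; omega
    · rw [List.mem_range] at hj'
      have := wire_inj n r k (by omega) (by omega) h2.symm; omega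
  · -- hs_d0
    rw [kit_d0, kit_hs, List.mem_map]
    rintro ⟨j, hj, h⟩
    rw [List.mem_range] at hj
    have := wire_inj n r k (by omega) (by omega) h; omega

end BlockKit

end Literature.Computability.QuantumComplexity
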